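import Summits.BirchSwinnertonDyer.BirchSwinnertonDyer.Theorems.EdgeCap.Negative.FibreStrassmann

/-!
# Stub D (`stub_contentDivision`) of line `ratio_measure_strassmann` for crux `TangentCone.EdgeCap` (stmt-BirchSwinnertonDyer-17609)

Target: `Summits/BirchSwinnertonDyer/BirchSwinnertonDyer/Theorems/TangentConeEdgeCapStubContentDivision.lean`
(`ledger propose --target <that> --file work/stubs/stub_contentDivision.lean --supports stmt-BirchSwinnertonDyer-17609`).
The theorem name and signature below are REGISTERED on the crux item; do not change them.

## Content: dividing out the vertical zeros of an integral two-variable `p`-adic series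

For `F ∈ ℤ_p⟦X₀, X₁⟧` (`IsPadicInt F`) with non-zero weight-2 fibre `F(0, Y) = Σ_i F_{0,i} Y^i` we factor,
on the open bidisc of `ℚ_p`, `F(x, y) = ∏_{z ∈ zs} (x − z) · Q(x, y)` with `Q` integral, `zs` a finite list
of non-zero points of the open disc, and no fibre `y ↦ Q(x, y)` (`‖x‖ < 1`) vanishing identically.

* `ContentDivision.exists_eq_X_sub_C_mul` — the division step: if every fibre coefficient
  `f_i(X₀) = Σ_m F_{m,i} X₀^m` vanishes at `z` (`‖z‖ < 1`), then `F = (X₀ − z) · Q` in `ℚ_p⟦X₀, X₁⟧` with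
  `Q_{m,i} = Σ_r F_{m+1+r,i} z^r` integral (coefficient comparison; `Summable.tsum_eq_zero_add`).
* `ContentDivision.exists_padicEval₂_ne_zero` — the stopping case: a fibre with a non-zero fibre
  coefficient is non-zero at some point of the `ℚ_p`-disc (fibre expansion
  `EdgeCap.Negative.padicEval₂_eq_tsum_fibre` + finiteness of the zeros of a non-zero element of
  `Λ = ℤ_p⟦Y⟧`, `MemIwasawaRat.finite_setOf_hasSum_zero`, along the injective sequence `(1+p)^n − 1`).
* `ContentDivision.conclusion_of_le_norm_coeff` — termination: under a division `F_{0,i₀} = −z · Q_{0,i₀}`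
  with `‖z‖ ≤ p⁻¹`, so `‖Q_{0,i₀}‖ ≥ p · ‖F_{0,i₀}‖` while `‖Q_{0,i₀}‖ ≤ 1`; induction on `N` with
  `p^{−N} ≤ ‖F_{0,i₀}‖` (in particular `z ≠ 0` automatically).

No definitions; evaluation calculus from `Literature.NumberTheory.EllipticCurves.PadicSeriesEvaluation`
(`padicEval₂_mul`, `padicEval₂_sub`, `padicEval₂_X`, `padicEval₂_C`).
-/

-- The directory layout `Summits/BirchSwinnertonDyer/BirchSwinnertonDyer/…` forces the duplicated segment.
set_option linter.dupNamespace false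

noncomputable section

namespace Summit.BirchSwinnertonDyer.BirchSwinnertonDyer.Theorems

namespace ContentDivision

open Literature.NumberTheory.EllipticCurves
open Summit.BirchSwinnertonDyer.BirchSwinnertonDyer.Theorems.EdgeCap.Negative

variable {p : ℕ} [Fact p.Prime]

/-! ## Monomial indices `(m, i) ↦ X₀^m X₁^i` -/

/-- Every exponent `d` on `Fin 2` is the monomial index `(d 0, d 1)`. [folklore] -/
theorem eq_idx (d : Fin 2 →₀ ℕ) : d = Finsupp.equivFunOnFinite.symm ![d 0, d 1] := by
  ext j; fin_cases j <;> simp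

/-- `Y^i = X₀^0 X₁^i`: the weight-2 fibre index. [folklore] -/
theorem single_one_eq_idx (i : ℕ) :
    (Finsupp.single 1 i : Fin 2 →₀ ℕ) = Finsupp.equivFunOnFinite.symm ![0, i] := by
  ext j; fin_cases j <;> simp

/-- `X₀` divides `X₀^{m+1} X₁^i`. [folklore] -/
theorem single_zero_le_idx_succ (m i : ℕ) :
    (Finsupp.single 0 1 : Fin 2 →₀ ℕ) ≤ Finsupp.equivFunOnFinite.symm ![m + 1, i] := by
  intro j; fin_cases j <;> simp

/-- `X₀` does not divide `X₁^i`. [folklore] -/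
theorem not_single_zero_le_idx_zero (i : ℕ) :
    ¬ (Finsupp.single 0 1 : Fin 2 →₀ ℕ) ≤ Finsupp.equivFunOnFinite.symm ![0, i] := by
  intro h; have h0 := h 0; simp at h0

/-- `X₀^{m+1} X₁^i / X₀ = X₀^m X₁^i`. [folklore] -/
theorem idx_succ_sub_single_zero (m i : ℕ) :
    (Finsupp.equivFunOnFinite.symm ![m + 1, i] : Fin 2 →₀ ℕ) - Finsupp.single 0 1 =
      Finsupp.equivFunOnFinite.symm ![m, i] := by
  ext j; fin_cases j <;> simp

/-! ## Coefficients of `(X₀ − z) · Q` -/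

/-- `[X₁^i] ((X₀ − z) Q) = −z · Q_{0,i}`. [folklore] -/
theorem coeff_idx_zero_X_sub_C_mul (z : ℚ_[p]) (Q : MvPowerSeries (Fin 2) ℚ_[p]) (i : ℕ) :
    MvPowerSeries.coeff (Finsupp.equivFunOnFinite.symm ![0, i])
        ((MvPowerSeries.X 0 - MvPowerSeries.C z) * Q) =
      -(z * MvPowerSeries.coeff (Finsupp.equivFunOnFinite.symm ![0, i]) Q) := by
  rw [sub_mul, map_sub, MvPowerSeries.coeff_C_mul, MvPowerSeries.X_def,
    MvPowerSeries.coeff_monomial_mul, if_neg (not_single_zero_le_idx_zero i), zero_sub]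

/-- `[X₀^{m+1} X₁^i] ((X₀ − z) Q) = Q_{m,i} − z · Q_{m+1,i}`. [folklore] -/
theorem coeff_idx_succ_X_sub_C_mul (z : ℚ_[p]) (Q : MvPowerSeries (Fin 2) ℚ_[p]) (m i : ℕ) :
    MvPowerSeries.coeff (Finsupp.equivFunOnFinite.symm ![m + 1, i])
        ((MvPowerSeries.X 0 - MvPowerSeries.C z) * Q) =
      MvPowerSeries.coeff (Finsupp.equivFunOnFinite.symm ![m, i]) Q -
        z * MvPowerSeries.coeff (Finsupp.equivFunOnFinite.symm ![m + 1, i]) Q := by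
  rw [sub_mul, map_sub, MvPowerSeries.coeff_C_mul, MvPowerSeries.X_def,
    MvPowerSeries.coeff_monomial_mul, if_pos (single_zero_le_idx_succ m i), one_mul,
    idx_succ_sub_single_zero]

/-! ## Tails of the fibre coefficient series -/

/-- The shifted coefficient series `Σ_r F_{k+r, i} z^r` converge on the open disc. [folklore] -/
theorem summable_coeff_shift_mul_pow {F : MvPowerSeries (Fin 2) ℚ_[p]} (hF : IsPadicInt F)
    {z : ℚ_[p]} (hz : ‖z‖ < 1) (k i : ℕ) :
    Summable fun r : ℕ =>
      MvPowerSeries.coeff (Finsupp.equivFunOnFinite.symm ![k + r, i]) F * z ^ r := by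
  refine Summable.of_norm_bounded (summable_geometric_of_lt_one (norm_nonneg z) hz) fun r => ?_
  rw [norm_mul, norm_pow]
  exact mul_le_of_le_one_left (pow_nonneg (norm_nonneg z) r) (hF _)

/-- The shifted coefficient series have norm `≤ 1`. [folklore] -/
theorem norm_tsum_coeff_shift_mul_pow_le_one {F : MvPowerSeries (Fin 2) ℚ_[p]} (hF : IsPadicInt F)
    {z : ℚ_[p]} (hz : ‖z‖ < 1) (k i : ℕ) :
    ‖∑' r : ℕ, MvPowerSeries.coeff (Finsupp.equivFunOnFinite.symm ![k + r, i]) F * z ^ r‖ ≤ 1 := by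
  refine IsUltrametricDist.norm_tsum_le_of_forall_le_of_nonneg zero_le_one fun r => ?_
  rw [norm_mul, norm_pow]
  calc ‖MvPowerSeries.coeff (Finsupp.equivFunOnFinite.symm ![k + r, i]) F‖ * ‖z‖ ^ r ≤ 1 * 1 := by
        gcongr
        · exact hF _
        · exact pow_le_one₀ (norm_nonneg z) hz.le
    _ = 1 := one_mul 1

/-! ## The division step `F = (X₀ − z) · Q` -/

/-- **Division by a vertical zero.** If `F ∈ ℤ_p⟦X₀, X₁⟧` and every fibre coefficient
`f_i(X₀) = Σ_m F_{m,i} X₀^m` vanishes at a point `z` of the open unit disc, then `F = (X₀ − z) · Q` with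
`Q ∈ ℤ_p⟦X₀, X₁⟧`, `Q_{m,i} = Σ_r F_{m+1+r, i} z^r`. [folklore] -/
theorem exists_eq_X_sub_C_mul (F : MvPowerSeries (Fin 2) ℚ_[p]) (hF : IsPadicInt F) {z : ℚ_[p]}
    (hz : ‖z‖ < 1)
    (hfc : ∀ i : ℕ,
      ∑' m : ℕ, MvPowerSeries.coeff (Finsupp.equivFunOnFinite.symm ![m, i]) F * z ^ m = 0) :
    ∃ Q : MvPowerSeries (Fin 2) ℚ_[p], IsPadicInt Q ∧
      (MvPowerSeries.X 0 - MvPowerSeries.C z) * Q = F := by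
  set Q : MvPowerSeries (Fin 2) ℚ_[p] := fun d =>
    ∑' r : ℕ, MvPowerSeries.coeff (Finsupp.equivFunOnFinite.symm ![d 0 + 1 + r, d 1]) F * z ^ r
    with hQ
  have hcoe : ∀ m i : ℕ, MvPowerSeries.coeff (Finsupp.equivFunOnFinite.symm ![m, i]) Q =
      ∑' r : ℕ, MvPowerSeries.coeff (Finsupp.equivFunOnFinite.symm ![m + 1 + r, i]) F * z ^ r := by
    intro m i
    show Q _ = _
    simp only [hQ, equivFunOnFinite_symm_vec_apply_zero, equivFunOnFinite_symm_vec_apply_one]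
  refine ⟨Q, fun d => ?_, ?_⟩
  · rw [eq_idx d, hcoe]
    exact norm_tsum_coeff_shift_mul_pow_le_one hF hz _ _
  · ext d
    rw [eq_idx d]
    rcases d 0 with _ | m
    · -- constant term in `X₀`: `−z Q_{0,i} = −Σ_{n ≥ 1} F_{n,i} z^n = F_{0,i} − f_i(z) = F_{0,i}`
      rw [coeff_idx_zero_X_sub_C_mul, hcoe]
      have h := (summable_coeff_shift_mul_pow hF hz 0 (d 1)).tsum_eq_zero_add
      simp only [zero_add, pow_zero, mul_one] at h
      rw [hfc (d 1)] at h
      -- `h : 0 = F_{0,i} + Σ_r F_{r+1,i} z^{r+1}`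
      have h' : ∑' r : ℕ, MvPowerSeries.coeff (Finsupp.equivFunOnFinite.symm ![r + 1, d 1]) F *
          z ^ (r + 1) = z * ∑' r : ℕ,
            MvPowerSeries.coeff (Finsupp.equivFunOnFinite.symm ![0 + 1 + r, d 1]) F * z ^ r := by
        rw [← tsum_mul_left]
        refine tsum_congr fun r => ?_
        rw [zero_add, add_comm 1 r, pow_succ]
        ring
      rw [← h']
      linear_combination h
    · -- `Q_{m,i} − z Q_{m+1,i} = F_{m+1,i}`
      rw [coeff_idx_succ_X_sub_C_mul, hcoe, hcoe,
        (summable_coeff_shift_mul_pow hF hz (m + 1) (d 1)).tsum_eq_zero_add]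
      simp only [add_zero, pow_zero, mul_one]
      have h' : ∑' r : ℕ, MvPowerSeries.coeff (Finsupp.equivFunOnFinite.symm ![m + 1 + (r + 1), d 1]) F *
          z ^ (r + 1) = z * ∑' r : ℕ,
            MvPowerSeries.coeff (Finsupp.equivFunOnFinite.symm ![m + 1 + 1 + r, d 1]) F * z ^ r := by
        rw [← tsum_mul_left]
        refine tsum_congr fun r => ?_
        rw [show m + 1 + (r + 1) = m + 1 + 1 + r by ring, pow_succ]
        ring
      rw [h']
      ring

/-- **Evaluation of the division identity**: `((X₀ − z) Q)(x, y) = (x − z) · Q(x, y)` on the open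
bidisc (`Q` integral, `‖z‖ ≤ 1`). [folklore] -/
theorem padicEval₂_X_sub_C_mul {Q : MvPowerSeries (Fin 2) ℚ_[p]} (hQ : IsPadicInt Q) {z x y : ℚ_[p]}
    (hz : ‖z‖ ≤ 1) (hx : ‖x‖ < 1) (hy : ‖y‖ < 1) :
    padicEval₂ ((MvPowerSeries.X 0 - MvPowerSeries.C z) * Q) x y = (x - z) * padicEval₂ Q x y := by
  rw [padicEval₂_mul ((IsPadicInt.X 0).sub (IsPadicInt.C hz)) hQ hx hy,
    padicEval₂_sub (IsPadicInt.X 0) (IsPadicInt.C hz) hx hy, padicEval₂_X, padicEval₂_C]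
  simp

/-! ## The stopping case: a fibre with a non-zero coefficient is non-zero somewhere (Strassmann) -/

/-- **A fibre with a non-zero fibre coefficient does not vanish on the disc.** If `F` is integral,
`‖x‖ < 1` and some `f_i(x) = Σ_m F_{m,i} x^m` is non-zero, then `F(x, y) ≠ 0` for some `‖y‖ < 1`:
otherwise the fibre series `Σ_i f_i(x) Y^i`, a non-zero element of `Λ = ℤ_p⟦Y⟧`, would vanish at the
infinitely many points `(1+p)^n − 1` of the disc, contradicting the finiteness of its zeros in the open
unit disc of `ℂ_p` (`MemIwasawaRat.finite_setOf_hasSum_zero`, `p`-adic Weierstrass preparation, Lang,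
*Cyclotomic Fields I–II*, Ch. 5 §2 Thm. 2.2; the argument of `EdgeCap.Negative.fibre_eq_zero_of_zeros`).
[cite: Lang1990, Ch. 5 §2 Thm. 2.2] -/
theorem exists_padicEval₂_ne_zero (F : MvPowerSeries (Fin 2) ℚ_[p]) (hF : IsPadicInt F) {x : ℚ_[p]}
    (hx : ‖x‖ < 1)
    (h : ∃ i : ℕ,
      ∑' m : ℕ, MvPowerSeries.coeff (Finsupp.equivFunOnFinite.symm ![m, i]) F * x ^ m ≠ 0) :
    ∃ y : ℚ_[p], ‖y‖ < 1 ∧ padicEval₂ F x y ≠ 0 := by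
  by_contra hcon
  push Not at hcon
  obtain ⟨i, hi⟩ := h
  apply hi
  -- the fibre coefficients and the fibre series `G ∈ Λ`, `L = G ⊗ ℚ_p`
  set f : ℕ → ℚ_[p] := fun i =>
    ∑' m : ℕ, MvPowerSeries.coeff (Finsupp.equivFunOnFinite.symm ![m, i]) F * x ^ m with hf
  have hf1 : ∀ i, ‖f i‖ ≤ 1 := fun i => norm_fibreCoeff_le_one hF hx i
  set G : PowerSeries ℤ_[p] := PowerSeries.mk fun i => ⟨f i, hf1 i⟩ with hG
  set L : PowerSeries ℚ_[p] := iwasawaToPowerSeries p G with hL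
  have hcoeff : ∀ k, PowerSeries.coeff k L = f k := fun k => by
    simp [hL, hG, iwasawaToPowerSeries, PowerSeries.coeff_map, PowerSeries.coeff_mk]
  -- evaluation of the fibre series at a point of the disc
  have hsum : ∀ y : ℚ_[p], ‖y‖ < 1 → HasSum (fun k : ℕ => f k * y ^ k) (padicEval₂ F x y) := by
    intro y hy
    rw [padicEval₂_eq_tsum_fibre hF hx hy]
    exact ((summable_geometric_of_lt_one (norm_nonneg _) hy).of_norm_bounded
      (f := fun k : ℕ => f k * y ^ k) fun k => by
        rw [norm_mul, norm_pow]
        exact mul_le_of_le_one_left (pow_nonneg (norm_nonneg _) _) (hf1 k)).hasSum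
  -- the fibre series is zero: it vanishes at the infinitely many points `(1+p)^n − 1`
  have hL0 : L = 0 := by
    by_contra hL0
    have hmem : MemIwasawaRat p L := memIwasawaRat_iwasawaToPowerSeries p G
    have hfin := MemIwasawaRat.finite_setOf_hasSum_zero hmem hL0
    set ι : ℚ_[p] →+* ℂ_[p] := algebraMap ℚ_[p] ℂ_[p] with hι
    set z : ℕ → ℚ_[p] := fun n => (1 + (p : ℚ_[p])) ^ n - 1 with hz
    have hzinj : Function.Injective z := one_add_pow_sub_one_injective p
    have hz1 : ∀ n, ‖z n‖ < 1 := norm_one_add_pow_sub_one_lt p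
    have hzι : Function.Injective fun n => ι (z n) := fun a b hab => hzinj (ι.injective hab)
    have hall : ∀ n, ι (z n) ∈ {w : ℂ_[p] | ‖w‖ < 1 ∧
        HasSum (fun k => algebraMap ℚ_[p] ℂ_[p] (PowerSeries.coeff k L) * w ^ k) 0} := by
      intro n
      refine ⟨?_, ?_⟩
      · show ‖ι (z n)‖ < 1
        rw [hι, norm_algebraMap']; exact hz1 n
      · have hs' := (hsum (z n) (hz1 n)).map ι.toAddMonoidHom (continuous_algebraMap ℚ_[p] ℂ_[p])
        rw [hcon (z n) (hz1 n), show ι.toAddMonoidHom (0 : ℚ_[p]) = 0 from map_zero _] at hs'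
        refine hs'.congr_fun fun k => ?_
        show ι (PowerSeries.coeff k L) * (ι (z n)) ^ k = ι.toAddMonoidHom (f k * (z n) ^ k)
        rw [hcoeff k]
        simp
    have huniv : (Set.univ : Set ℕ).Finite :=
      (hfin.preimage hzι.injOn).subset fun n _ => hall n
    exact Set.infinite_univ huniv
  show f i = 0
  rw [← hcoeff i, hL0, map_zero]

/-- The stopping case of the division: if NO point of the disc is a common zero of all fibre
coefficients, then `F` itself (with the empty list of vertical zeros) answers the stub. [folklore] -/
theorem conclusion_of_no_vertical_zero (F : MvPowerSeries (Fin 2) ℚ_[p]) (hF : IsPadicInt F)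
    (h : ¬ ∃ z : ℚ_[p], ‖z‖ < 1 ∧ ∀ i : ℕ,
      ∑' m : ℕ, MvPowerSeries.coeff (Finsupp.equivFunOnFinite.symm ![m, i]) F * z ^ m = 0) :
    ∃ (Q : MvPowerSeries (Fin 2) ℚ_[p]) (zs : List ℚ_[p]), IsPadicInt Q ∧
      (∀ z ∈ zs, z ≠ 0 ∧ ‖z‖ < 1) ∧
      (∀ x y : ℚ_[p], ‖x‖ < 1 → ‖y‖ < 1 →
        padicEval₂ F x y = (zs.map fun z => x - z).prod * padicEval₂ Q x y) ∧
      (∀ x : ℚ_[p], ‖x‖ < 1 → ∃ y : ℚ_[p], ‖y‖ < 1 ∧ padicEval₂ Q x y ≠ 0) := by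
  refine ⟨F, [], hF, fun z hz => by simp at hz, fun x y _ _ => by simp, fun x hx => ?_⟩
  refine exists_padicEval₂_ne_zero F hF hx ?_
  by_contra hall
  push Not at hall
  exact h ⟨x, hx, hall⟩

/-! ## Iterating the division: induction on the valuation of the weight-2 coefficient `F_{0,i₀}` -/

/-- **Content division, quantitative form.** For an integral `F` with `‖F_{0,i₀}‖ ≥ p^{-N}`, the
vertical zeros can be divided out in at most `N` steps: each division `F = (X₀ − z) Q` by a common
zero `z` of the fibre coefficients (`‖z‖ < 1`, so `‖z‖ ≤ p⁻¹`) gives `F_{0,i₀} = −z Q_{0,i₀}`, whence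
`‖Q_{0,i₀}‖ ≥ p ‖F_{0,i₀}‖` while `‖Q_{0,i₀}‖ ≤ 1`. [folklore] -/
theorem conclusion_of_le_norm_coeff (i₀ : ℕ) :
    ∀ (N : ℕ) (F : MvPowerSeries (Fin 2) ℚ_[p]), IsPadicInt F →
      (p : ℝ)⁻¹ ^ N ≤ ‖MvPowerSeries.coeff (Finsupp.equivFunOnFinite.symm ![0, i₀]) F‖ →
      ∃ (Q : MvPowerSeries (Fin 2) ℚ_[p]) (zs : List ℚ_[p]), IsPadicInt Q ∧
        (∀ z ∈ zs, z ≠ 0 ∧ ‖z‖ < 1) ∧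
        (∀ x y : ℚ_[p], ‖x‖ < 1 → ‖y‖ < 1 →
          padicEval₂ F x y = (zs.map fun z => x - z).prod * padicEval₂ Q x y) ∧
        (∀ x : ℚ_[p], ‖x‖ < 1 → ∃ y : ℚ_[p], ‖y‖ < 1 ∧ padicEval₂ Q x y ≠ 0) := by
  have hp1 : 1 < (p : ℝ) := by exact_mod_cast (Fact.out : p.Prime).one_lt
  have hp0 : 0 < (p : ℝ)⁻¹ := inv_pos.mpr (lt_trans zero_lt_one hp1)
  intro N
  induction N with
  | zero =>
    intro F hF hN
    by_cases hex : ∃ z : ℚ_[p], ‖z‖ < 1 ∧ ∀ i : ℕ,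
        ∑' m : ℕ, MvPowerSeries.coeff (Finsupp.equivFunOnFinite.symm ![m, i]) F * z ^ m = 0
    · -- a vertical zero would force `1 ≤ ‖F_{0,i₀}‖ = ‖z‖ ‖Q_{0,i₀}‖ < 1`
      exfalso
      obtain ⟨z, hz, hfc⟩ := hex
      obtain ⟨Q, hQ, hQF⟩ := exists_eq_X_sub_C_mul F hF hz hfc
      have hcoeff := coeff_idx_zero_X_sub_C_mul z Q i₀
      rw [hQF] at hcoeff
      rw [pow_zero, hcoeff, norm_neg, norm_mul] at hN
      have hlt : ‖z‖ * ‖MvPowerSeries.coeff (Finsupp.equivFunOnFinite.symm ![0, i₀]) Q‖ < 1 :=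
        calc ‖z‖ * ‖MvPowerSeries.coeff (Finsupp.equivFunOnFinite.symm ![0, i₀]) Q‖ ≤ ‖z‖ * 1 :=
              mul_le_mul_of_nonneg_left (hQ _) (norm_nonneg z)
          _ < 1 := by rw [mul_one]; exact hz
      exact absurd (lt_of_le_of_lt hN hlt) (lt_irrefl 1)
    · exact conclusion_of_no_vertical_zero F hF hex
  | succ N ih =>
    intro F hF hN
    by_cases hex : ∃ z : ℚ_[p], ‖z‖ < 1 ∧ ∀ i : ℕ,
        ∑' m : ℕ, MvPowerSeries.coeff (Finsupp.equivFunOnFinite.symm ![m, i]) F * z ^ m = 0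
    · obtain ⟨z, hz, hfc⟩ := hex
      obtain ⟨Q, hQ, hQF⟩ := exists_eq_X_sub_C_mul F hF hz hfc
      have hcoeff := coeff_idx_zero_X_sub_C_mul z Q i₀
      rw [hQF] at hcoeff
      -- `‖z‖ ≤ p⁻¹`
      have hzp : ‖z‖ ≤ (p : ℝ)⁻¹ := by
        have h := (Padic.norm_le_pow_iff_norm_lt_pow_add_one z (-1)).mpr (by simpa using hz)
        simpa using h
      -- the measure drops: `p^{-N} ≤ ‖Q_{0,i₀}‖`
      have hNQ : (p : ℝ)⁻¹ ^ N ≤ ‖MvPowerSeries.coeff (Finsupp.equivFunOnFinite.symm ![0, i₀]) Q‖ := by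
        rw [pow_succ', hcoeff, norm_neg, norm_mul] at hN
        exact le_of_mul_le_mul_left
          (hN.trans (mul_le_mul_of_nonneg_right hzp (norm_nonneg _))) hp0
      -- `z ≠ 0` since `F_{0,i₀} = −z Q_{0,i₀} ≠ 0`
      have hF0 : MvPowerSeries.coeff (Finsupp.equivFunOnFinite.symm ![0, i₀]) F ≠ 0 := by
        intro h0
        rw [h0, norm_zero] at hN
        exact not_lt.mpr hN (pow_pos hp0 _)
      have hz0 : z ≠ 0 := by
        rintro rfl
        exact hF0 (by rw [hcoeff]; simp)
      obtain ⟨Q', zs, hQ', hzs, heval, hne⟩ := ih Q hQ hNQ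
      refine ⟨Q', z :: zs, hQ', ?_, fun x y hx hy => ?_, hne⟩
      · intro w hw
        rw [List.mem_cons] at hw
        rcases hw with rfl | hw
        · exact ⟨hz0, hz⟩
        · exact hzs w hw
      · rw [← hQF, padicEval₂_X_sub_C_mul hQ hz.le hx hy, heval x y hx hy, List.map_cons,
          List.prod_cons, mul_assoc]
    · exact conclusion_of_no_vertical_zero F hF hex

end ContentDivision

/-- **Stub D (`stub_contentDivision`) of line `ratio_measure_strassmann` for crux `TangentCone.EdgeCap` (stmt-BirchSwinnertonDyer-17609):** dividing out the vertical zeros of an integral two-variable `p`-adic series with non-zero weight-2 fibre. -/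
theorem stub_contentDivision :
    ∀ (p : ℕ) [Fact p.Prime] (F : MvPowerSeries (Fin 2) ℚ_[p]), Literature.NumberTheory.EllipticCurves.IsPadicInt F → (∃ i : ℕ, MvPowerSeries.coeff (Finsupp.single 1 i) F ≠ 0) → ∃ (Q : MvPowerSeries (Fin 2) ℚ_[p]) (zs : List ℚ_[p]), Literature.NumberTheory.EllipticCurves.IsPadicInt Q ∧ (∀ z ∈ zs, z ≠ 0 ∧ ‖z‖ < 1) ∧ (∀ x y : ℚ_[p], ‖x‖ < 1 → ‖y‖ < 1 → Literature.NumberTheory.EllipticCurves.padicEval₂ F x y = (zs.map fun z => x - z).prod * Literature.NumberTheory.EllipticCurves.padicEval₂ Q x y) ∧ (∀ x : ℚ_[p], ‖x‖ < 1 → ∃ y : ℚ_[p], ‖y‖ < 1 ∧ Literature.NumberTheory.EllipticCurves.padicEval₂ Q x y ≠ 0) := by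
  intro p _ F hF hi
  obtain ⟨i₀, hi₀⟩ := hi
  rw [ContentDivision.single_one_eq_idx] at hi₀
  have hp1 : 1 < (p : ℝ) := by exact_mod_cast (Fact.out : p.Prime).one_lt
  obtain ⟨N, hN⟩ := exists_pow_lt_of_lt_one (norm_pos_iff.mpr hi₀) (inv_lt_one_of_one_lt₀ hp1)
  exact ContentDivision.conclusion_of_le_norm_coeff i₀ N F hF hN.le

end Summit.BirchSwinnertonDyer.BirchSwinnertonDyer.Theorems

end
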